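import Mathlib.NumberTheory.Chebyshev
import HarnessLib

/-!
# Chebyshev's explicit upper bound for `π(x)` with a free cut-off: `π(x) ≤ (log 4) x/log y + y`

Topic `Summits/QuantumAdvantage/QuantumAdvantage/Theorems`, helper for the crux `PrimeClassesSpread`
(stmt-QuantumAdvantage-11613) of route `DarkClassGroups`.
HONEST FRAMING: the value of this file is a THEOREM (kernel-checked) — not summit progress.

Mathlib's `Chebyshev.pi_le_log4_mul_div` is the case `y = √x` of the bound
`π(x) log y ≤ θ(x) + π(y) log y ≤ (log 4) x + y log y` (a prime `p ≤ x` has `log p ≥ log y` unless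
`p ≤ y`), i.e. `π(x) ≤ 2 (log 4) x/log x + √x`.  With `y = x^{1−δ}` the constant drops to
`(log 4)/(1 − δ)`, which the abundance half of `PrimeClassesSpread` needs (`3 · (29/32) > 1.55 > 2 log 4` fails,
`3 · (29/32) = 2.72 > (10/9) log 4 = 1.54` holds):

* `primeCounting_mul_log_le` — `π(⌊x⌋) log y ≤ (log 4) x + y log y` for `0 ≤ x`, `1 ≤ y`;
* `primeCounting_le_log4_mul_div_log_add` — `π(⌊x⌋) ≤ (log 4) x/log y + y` for `0 ≤ x`, `1 < y`.
-/

open Nat hiding log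
open Finset Real

namespace Summit.QuantumAdvantage.QuantumAdvantage.Theorems.PrimeClassesSpread

open Chebyshev

/-- **`π(⌊x⌋) · log y ≤ (log 4) x + y log y`** for `0 ≤ x` and `1 ≤ y`: split the primes `p ≤ x` at `y`;
those above `y` have `log p > log y` and contribute at most `θ(x) ≤ (log 4) x`, those below number at most
`⌊y⌋ ≤ y`. [cite: MontgomeryVaughan2007, Theorem 2.4 (Chebyshev)] -/
theorem primeCounting_mul_log_le {x y : ℝ} (hx : 0 ≤ x) (hy : 1 ≤ y) :
    (Nat.primeCounting ⌊x⌋₊ : ℝ) * Real.log y ≤ Real.log 4 * x + y * Real.log y := by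
  have hlogy : 0 ≤ Real.log y := Real.log_nonneg hy
  calc (Nat.primeCounting ⌊x⌋₊ : ℝ) * Real.log y = ∑ _p ∈ primesLE ⌊x⌋₊, Real.log y := by
        rw [sum_const, nsmul_eq_mul, primesLE_card_eq_primeCounting]
    _ ≤ ∑ p ∈ primesLE ⌊x⌋₊, (Real.log p + if (p : ℝ) ≤ y then Real.log y else 0) := by
        refine sum_le_sum fun p hp ↦ ?_
        have hp2 := (prime_of_mem_primesLE hp).two_le
        have hlogp : 0 ≤ Real.log p := Real.log_nonneg (by exact_mod_cast (by omega : 1 ≤ p))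
        split_ifs with h
        · linarith
        · have : Real.log y < Real.log p := Real.log_lt_log (by linarith) (not_le.mp h)
          linarith
    _ = θ x + ∑ p ∈ primesLE ⌊x⌋₊, (if (p : ℝ) ≤ y then Real.log y else 0) := by
        rw [sum_add_distrib, theta_eq_sum_primesLE]
    _ ≤ Real.log 4 * x + y * Real.log y := by
        refine add_le_add (theta_le_log4_mul_x hx) ?_
        rw [← sum_filter, sum_const, nsmul_eq_mul]
        refine mul_le_mul_of_nonneg_right ?_ hlogy
        have hcard : ((primesLE ⌊x⌋₊).filter (fun p : ℕ ↦ (p : ℝ) ≤ y)).card ≤ ⌊y⌋₊ := by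
          calc ((primesLE ⌊x⌋₊).filter (fun p : ℕ ↦ (p : ℝ) ≤ y)).card ≤ (Icc 1 ⌊y⌋₊).card := by
                refine card_le_card fun p hp ↦ ?_
                simp only [mem_filter, mem_primesLE] at hp
                rw [mem_Icc]
                exact ⟨hp.1.2.one_le, Nat.le_floor hp.2⟩
            _ = ⌊y⌋₊ := by simp
        calc (((primesLE ⌊x⌋₊).filter (fun p : ℕ ↦ (p : ℝ) ≤ y)).card : ℝ) ≤ (⌊y⌋₊ : ℝ) := by
              exact_mod_cast hcard
          _ ≤ y := Nat.floor_le (by linarith)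

/-- **`π(⌊x⌋) ≤ (log 4) x/log y + y`** for `0 ≤ x`, `1 < y` (Chebyshev's bound with a free cut-off
`y`; `y = √x` is Mathlib's `Chebyshev.pi_le_log4_mul_div`). [cite: MontgomeryVaughan2007, Theorem 2.4 (Chebyshev)] -/
theorem primeCounting_le_log4_mul_div_log_add {x y : ℝ} (hx : 0 ≤ x) (hy : 1 < y) :
    (Nat.primeCounting ⌊x⌋₊ : ℝ) ≤ Real.log 4 * x / Real.log y + y := by
  have hlogy : 0 < Real.log y := Real.log_pos hy
  have h := primeCounting_mul_log_le hx hy.le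
  rw [div_add' _ _ _ hlogy.ne', le_div_iff₀ hlogy]
  linarith

end Summit.QuantumAdvantage.QuantumAdvantage.Theorems.PrimeClassesSpread
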